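import Mathlib.Algebra.Module.ZLattice.Basic
import Mathlib.Analysis.SpecialFunctions.Trigonometric.Basic

/-!
# Crux `AnchorGap` (stmt-QuantumFields-11141), line `registered` — the dual lattice has a `ℤ`-basis

For a SPANNING charge family `α : Fin M → ℝᵏ` (`∀ v, (∀ r, α_r · v = 0) → v = 0`) that is
COMMENSURATE (the dual set `Λ* = {w | ∀ r, α_r · w ∈ 2πℤ}` contains `k` linearly independent
vectors), the dual set `Λ*` is a full `ℤ`-lattice of `ℝᵏ`: it has a `ℤ`-basis `b'` of `k` vectors
which are linearly independent over `ℝ`, and every dual vector is an INTEGER combination of them.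
This is the form in which the zero-mode sectors `θ ∈ Λ*` of the compact sine-Gordon gas are
enumerated (helper toward stub `stub_sgRepCore` of the skeleton `Cruxes/AnchorGap/Lines/birth.lean`).

Proof: `Λ*` is a `ℤ`-submodule of `ℝᵏ`; it is DISCRETE (a non-zero `w ∈ Λ*` has some
`|α_r · w| ≥ 2π` by spanning, and `|α_r · w| ≤ C ‖w‖_∞` with `C = 1 + Σ_r Σ_a |α r a|`, so
`‖w‖_∞ ≥ 2π / C`) and it SPANS `ℝᵏ` over `ℝ` (it contains the `ℝ`-basis `b`), i.e. it is a
`ZLattice`; Mathlib's `IsZLattice.basis` / `Basis.ofZLatticeBasis` then provide a `ℤ`-basis indexed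
by `Fin k` which is also an `ℝ`-basis of `ℝᵏ`.
-/

set_option autoImplicit false

noncomputable section

namespace Summit.QuantumFields.YangMills.Theorems.AnchorGap

open Module

/-- **The dual lattice of a spanning, commensurate charge family has a `ℤ`-basis**: if the charges
`α_r` span `ℝᵏ` (only `0` is orthogonal to all of them) and the dual set
`Λ* = {w | ∀ r, α_r · w ∈ 2πℤ}` contains `k` linearly independent vectors, then there are `k`
linearly independent vectors `b'_j ∈ Λ*` such that every `w ∈ Λ*` is `Σ_j n_j b'_j` with INTEGER
coefficients `n_j` — `Λ*` is a discrete (`‖w‖_∞ ≥ 2π / (1 + Σ_r Σ_a |α r a|)` for `w ≠ 0`) and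
`ℝ`-spanning `ℤ`-submodule of `ℝᵏ`, hence a full `ℤ`-lattice, and a `ℤ`-basis of a full lattice is
an `ℝ`-basis (`IsZLattice.basis`, `Basis.ofZLatticeBasis`). [folklore] -/
theorem dualLattice_basis : ∀ (k M : ℕ) (α : Fin M → Fin k → ℝ), (∀ v : Fin k → ℝ, (∀ r : Fin M, ∑ a : Fin k, α r a * v a = 0) → v = 0) → ∀ (b : Fin k → Fin k → ℝ), LinearIndependent ℝ b → (∀ (j : Fin k) (r : Fin M), ∃ z : ℤ, ∑ a : Fin k, α r a * b j a = 2 * Real.pi * z) → ∃ b' : Fin k → Fin k → ℝ, LinearIndependent ℝ b' ∧ (∀ (j : Fin k) (r : Fin M), ∃ z : ℤ, ∑ a : Fin k, α r a * b' j a = 2 * Real.pi * z) ∧ ∀ w : Fin k → ℝ, (∀ r : Fin M, ∃ z : ℤ, ∑ a : Fin k, α r a * w a = 2 * Real.pi * z) → ∃ n : Fin k → ℤ, w = fun a => ∑ j : Fin k, (n j : ℝ) * b' j a := by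
  intro k M α hspan b hb hcomm
  -- the dual set `Λ*` as a `ℤ`-submodule of `ℝᵏ`
  let L : Submodule ℤ (Fin k → ℝ) :=
    { carrier := {w | ∀ r : Fin M, ∃ z : ℤ, ∑ a : Fin k, α r a * w a = 2 * Real.pi * z}
      zero_mem' := fun r => ⟨0, by simp⟩
      add_mem' := by
        intro u v hu hv r
        obtain ⟨z₁, h₁⟩ := hu r
        obtain ⟨z₂, h₂⟩ := hv r
        refine ⟨z₁ + z₂, ?_⟩
        have : ∑ a : Fin k, α r a * (u + v) a
            = ∑ a : Fin k, α r a * u a + ∑ a : Fin k, α r a * v a := by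
          rw [← Finset.sum_add_distrib]
          exact Finset.sum_congr rfl fun a _ => by rw [Pi.add_apply, mul_add]
        rw [this, h₁, h₂]
        push_cast
        ring
      smul_mem' := by
        intro n w hw r
        obtain ⟨z, hz⟩ := hw r
        refine ⟨n * z, ?_⟩
        have : ∑ a : Fin k, α r a * (n • w) a = (n : ℝ) * ∑ a : Fin k, α r a * w a := by
          rw [Finset.mul_sum]
          exact Finset.sum_congr rfl fun a _ => by rw [Pi.smul_apply, zsmul_eq_mul]; ring
        rw [this, hz]
        push_cast
        ring }
  -- uniform discreteness: a non-zero dual vector has sup-norm `≥ 2π / C`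
  set C : ℝ := 1 + ∑ r : Fin M, ∑ a : Fin k, |α r a| with hCdef
  have hC : 0 < C := by
    have : 0 ≤ ∑ r : Fin M, ∑ a : Fin k, |α r a| :=
      Finset.sum_nonneg fun r _ => Finset.sum_nonneg fun a _ => abs_nonneg _
    linarith
  have hgap : ∀ w : Fin k → ℝ, w ∈ L → w ≠ 0 → 2 * Real.pi / C ≤ ‖w‖ := by
    intro w hw hw0
    have hex : ∃ r : Fin M, ∑ a : Fin k, α r a * w a ≠ 0 := by
      by_contra h
      push Not at h
      exact hw0 (hspan w h)
    obtain ⟨r, hr⟩ := hex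
    obtain ⟨z, hz⟩ := hw r
    have hz0 : z ≠ 0 := by
      rintro rfl
      rw [Int.cast_zero, mul_zero] at hz
      exact hr hz
    have h1 : (1 : ℝ) ≤ |(z : ℝ)| := by
      rw [← Int.cast_abs]
      exact_mod_cast Int.one_le_abs hz0
    have hge : 2 * Real.pi ≤ |∑ a : Fin k, α r a * w a| := by
      rw [hz, abs_mul, abs_of_pos Real.two_pi_pos]
      nlinarith [Real.two_pi_pos]
    have hle : |∑ a : Fin k, α r a * w a| ≤ C * ‖w‖ := by
      calc |∑ a : Fin k, α r a * w a| ≤ ∑ a : Fin k, |α r a * w a| :=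
            Finset.abs_sum_le_sum_abs _ _
        _ ≤ ∑ a : Fin k, |α r a| * ‖w‖ := Finset.sum_le_sum fun a _ => by
            rw [abs_mul]
            refine mul_le_mul_of_nonneg_left ?_ (abs_nonneg _)
            have := norm_le_pi_norm w a
            rwa [Real.norm_eq_abs] at this
        _ = (∑ a : Fin k, |α r a|) * ‖w‖ := (Finset.sum_mul _ _ _).symm
        _ ≤ C * ‖w‖ := by
            refine mul_le_mul_of_nonneg_right ?_ (norm_nonneg _)
            have : ∑ a : Fin k, |α r a| ≤ ∑ r' : Fin M, ∑ a : Fin k, |α r' a| :=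
              Finset.single_le_sum (f := fun r' : Fin M => ∑ a : Fin k, |α r' a|)
                (fun r' _ => Finset.sum_nonneg fun a _ => abs_nonneg _) (Finset.mem_univ r)
            linarith
    rw [div_le_iff₀ hC]
    calc 2 * Real.pi ≤ C * ‖w‖ := hge.trans hle
      _ = ‖w‖ * C := mul_comm _ _
  haveI hdisc : DiscreteTopology L := by
    refine DiscreteTopology.of_forall_le_norm (div_pos Real.two_pi_pos hC) fun x hx => ?_
    have hx0 : (x : Fin k → ℝ) ≠ 0 := fun h => hx (Subtype.ext h)
    rw [Submodule.coe_norm]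
    exact hgap x x.2 hx0
  -- `Λ*` spans `ℝᵏ` over `ℝ`: it contains the `ℝ`-basis `b`
  haveI hlat : IsZLattice ℝ L := by
    refine ⟨?_⟩
    rcases isEmpty_or_nonempty (Fin k) with hk | hk
    · exact eq_top_iff.2 fun v _ => by rw [Subsingleton.elim v 0]; exact Submodule.zero_mem _
    have hcard : Fintype.card (Fin k) = Module.finrank ℝ (Fin k → ℝ) := by simp
    have hB := (basisOfLinearIndependentOfCardEqFinrank hb hcard).span_eq
    rw [coe_basisOfLinearIndependentOfCardEqFinrank] at hB
    rw [eq_top_iff, ← hB]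
    refine Submodule.span_mono ?_
    rintro _ ⟨j, rfl⟩
    exact fun r => hcomm j r
  -- a `ℤ`-basis of `Λ*` indexed by `Fin k`; it is an `ℝ`-basis of `ℝᵏ`
  let B : Basis (Fin k) ℤ L := IsZLattice.basis L
  refine ⟨fun j => ((B j : L) : Fin k → ℝ), ?_, fun j r => (B j).2 r, fun w hw => ?_⟩
  · have : (fun j => ((B j : L) : Fin k → ℝ)) = ⇑(B.ofZLatticeBasis ℝ L) := by
      funext j
      rw [Basis.ofZLatticeBasis_apply]
    rw [this]
    exact (B.ofZLatticeBasis ℝ L).linearIndependent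
  · refine ⟨fun j => B.repr ⟨w, hw⟩ j, ?_⟩
    have hsum := (B.ofZLatticeBasis ℝ L).sum_repr w
    have hrepr : ∀ j : Fin k, (B.ofZLatticeBasis ℝ L).repr w j = ((B.repr ⟨w, hw⟩ j : ℤ) : ℝ) :=
      fun j => B.ofZLatticeBasis_repr_apply ℝ L ⟨w, hw⟩ j
    funext a
    conv_lhs => rw [← hsum]
    rw [Finset.sum_apply]
    refine Finset.sum_congr rfl fun j _ => ?_
    rw [Pi.smul_apply, smul_eq_mul, hrepr j, Basis.ofZLatticeBasis_apply]

end Summit.QuantumFields.YangMills.Theorems.AnchorGap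

end
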